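import Mathlib.Analysis.Analytic.IsolatedZeros
import Mathlib.Analysis.Analytic.Constructions
import Mathlib.Analysis.Complex.Basic
import Mathlib.LinearAlgebra.Finsupp.LinearCombination
import HarnessLib

/-!
# An entire function vanishing on a translate of a real subspace vanishes on its complex span

Topic: `Literature/Analysis/Complex`. A small identity-theorem lemma used by the theta-model
programme towards `Literature.NumberTheory.Transcendental.philippon1986_std` (orbit closures in
the directions of the elliptic factors: the topological closure of `ℤ r + Λ^γ` contributes a REAL
subtorus, whose directions must be complexified):

* `Literature.Analysis.Complex.vanish_on_complexSpan_of_vanish_on_realSpan` — if `F : E → ℂ` is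
  analytic on the complex normed space `E` and `F(w + x) = 0` for all `x` in the REAL span of a set
  `S`, then `F(w + x) = 0` for all `x` in the COMPLEX span of `S`.

Proof: for `x` already reached, `s ∈ S` and `y ∈ span_ℝ S`, the entire function
`c ↦ F(w + y + x + c s)` vanishes for real `c`, hence identically (identity theorem); induct over a
representation `∑ cᵢ sᵢ`. Everything is PROVED. [folklore]

## References

* L. Hörmander, *An Introduction to Complex Analysis in Several Variables*, 3rd ed., North-Holland
  1990, Thm. 2.2.? (uniqueness of analytic continuation; a real-analytic slice determines the
  function) — the statement here is the elementary special case. [folklore]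
-/

noncomputable section

open Filter Topology Set

namespace Literature.Analysis.Complex

variable {E : Type*} [NormedAddCommGroup E] [NormedSpace ℂ E]

/-- **One more complex direction**: if `F(w + y + x) = 0` for all `y ∈ span_ℝ S` then, for `s ∈ S`,
`F(w + y + (x + c s)) = 0` for all complex `c` and all `y ∈ span_ℝ S` (identity theorem on the
complex line `c ↦ w + y + x + c s`, which vanishes for real `c`). [folklore] -/
theorem vanish_add_smul_of_vanish {F : E → ℂ} (hF : AnalyticOnNhd ℂ F univ) (w : E) (S : Set E)
    {x : E} (hx : ∀ y ∈ Submodule.span ℝ S, F (w + y + x) = 0) {s : E} (hs : s ∈ S) (c : ℂ)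
    {y : E} (hy : y ∈ Submodule.span ℝ S) : F (w + y + (x + c • s)) = 0 := by
  set g : ℂ → ℂ := fun c => F (w + y + x + c • s) with hg
  have hga : AnalyticOnNhd ℂ g univ := by
    intro c _
    have haff : AnalyticAt ℂ (fun c : ℂ => w + y + x + c • s) c :=
      analyticAt_const.add ((analyticAt_id).smul analyticAt_const)
    exact (hF _ (mem_univ _)).comp haff
  have hreal : ∀ t : ℝ, g (t : ℂ) = 0 := fun t => by
    have hmem : y + t • s ∈ Submodule.span ℝ S :=
      Submodule.add_mem _ hy (Submodule.smul_mem _ _ (Submodule.subset_span hs))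
    have := hx _ hmem
    simp only [hg, Complex.coe_smul]
    rwa [← add_assoc, add_right_comm _ _ x] at this
  have hfreq : ∃ᶠ c in 𝓝[≠] (0 : ℂ), g c = 0 := by
    have htend : Tendsto (fun t : ℝ => (t : ℂ)) (𝓝[≠] 0) (𝓝[≠] 0) := by
      refine (Complex.continuous_ofReal.continuousWithinAt).tendsto_nhdsWithin ?_
      intro t ht
      simpa using ht
    exact htend.frequently (Eventually.of_forall fun t => hreal t).frequently
  have h0 := hga.eqOn_zero_of_preconnected_of_frequently_eq_zero isPreconnected_univ (mem_univ 0) hfreq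
    (mem_univ c)
  simpa [hg, add_assoc] using h0

/-- **An entire function vanishing on `w + span_ℝ S` vanishes on `w + span_ℂ S`.** [folklore] -/
theorem vanish_on_complexSpan_of_vanish_on_realSpan {F : E → ℂ} (hF : AnalyticOnNhd ℂ F univ)
    (w : E) (S : Set E) (h : ∀ x ∈ Submodule.span ℝ S, F (w + x) = 0) :
    ∀ x ∈ Submodule.span ℂ S, F (w + x) = 0 := by
  -- all finite sums `∑ cᵢ sᵢ` are reached, uniformly in the real base point `y`
  have key : ∀ (n : ℕ) (f : Fin n → ℂ) (g : Fin n → S),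
      ∀ y ∈ Submodule.span ℝ S, F (w + y + ∑ i, f i • (g i : E)) = 0 := by
    intro n
    induction n with
    | zero =>
      intro f g y hy
      simpa using h y hy
    | succ n ih =>
      intro f g y hy
      rw [Fin.sum_univ_castSucc]
      exact vanish_add_smul_of_vanish hF w S (ih (fun i => f (Fin.castSucc i)) fun i => g (Fin.castSucc i))
        (g (Fin.last n)).2 _ hy
  intro x hx
  obtain ⟨n, f, g, rfl⟩ := Submodule.mem_span_set'.mp hx
  simpa using key n f g 0 (Submodule.zero_mem _)

/-- The same with the base point absorbed: vanishing on `span_ℝ S` gives vanishing on `span_ℂ S`.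
[folklore] -/
theorem vanish_on_complexSpan_of_vanish_on_realSpan₀ {F : E → ℂ} (hF : AnalyticOnNhd ℂ F univ)
    (S : Set E) (h : ∀ x ∈ Submodule.span ℝ S, F x = 0) :
    ∀ x ∈ Submodule.span ℂ S, F x = 0 := by
  have := vanish_on_complexSpan_of_vanish_on_realSpan hF 0 S (by simpa using h)
  simpa using this

end Literature.Analysis.Complex

end
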